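import Literature.Topology.FourManifolds.SphereSurgeryStep
import Literature.Topology.FourManifolds.SphereSurgeryOrientation
import Literature.Topology.FourManifolds.HomotopySpheresBPOrderSignatureLeaves
import Literature.Topology.FourManifolds.HomotopySpheresProofs
import Literature.AlgebraicTopology.SingularHomology.HurewiczSpherical
import Literature.AlgebraicTopology.SingularHomology.HurewiczProofs
import Literature.AlgebraicTopology.SingularHomology.HurewiczTheoremProofs
import Literature.AlgebraicTopology.SingularHomology.BoundaryManifoldFiniteness
import HarnessLib

/-!
# Framed surgery below the middle dimension: the induction of Kosinski X.2.2, modulo X.2.1 and `σ`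

Topic `Literature/Topology/FourManifolds` (fact seat of
`Literature.Topology.FourManifolds.HomotopySphere.exists_highlyConnected_of_mem_signatureSet`,
brick B9c: the assembly).  A. Kosinski, *Differential Manifolds* (1993), Ch. X §2, Thm. (2.2),
p. 201 (and Kervaire–Milnor 1963, Thm. 5.5): *a compact s-parallelizable `W` of dimension `2k`
(`≥ 6`) bounded by a homotopy sphere can be made `(k-1)`-connected by a finite sequence of framed
surgeries of index `≤ k`, without changing `∂W`, s-parallelizability, or (X.3.3, p. 206) the
signature.*  Printed proof: make `W` connected and simply connected by `0`- and `1`-surgeries;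
then inductively, `W` being `(j-1)`-connected with `j < k`, `H_j W` is finitely generated, every
generator is spherical (Hurewicz) and is represented by a framed embedded `j`-sphere with
s-parallelizable trace (X.2.1, from Whitney's embedding theorem and the stability of
`π_{j-1} SO`), and surgery on it leaves `W` `(j-1)`-connected with `H_j` generated by fewer
elements (X.1.1); after finitely many steps `W` is `j`-connected.

This file PROVES that induction for `dim W = n + 1 = 4m ≥ 8`, `k = 2m`, in the language of the
tree (`NullCobordism`, `FramedSphereFamily`, `NullCobordism.surgery`, `signatureSet`), from the
proved bricks

* spherical representability `exists_sphereMap_of_connected` (`HurewiczSpherical.lean`) and the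
  Hurewicz theorems `hurewicz_iso_of_collapseDevice` (`= hurewicz_iso_holds`), `hurewicz_one_holds`;
* one surgery step: `FramedSphereFamily.simplyConnectedSpace_surgered`,
  `isZero_singularHomology_surgered`, `exists_generators_surgered` (`SphereSurgeryStep.lean`);
* orientation bookkeeping `NullCobordism.exists_isOrientedBy_surgery`
  (`SphereSurgeryOrientation.lean`, `NullCobordismOrientedBy.lean`);
* finiteness of the homology of compact manifolds with boundary
  (`finite_singularHomology_of_compact_chartedSpace_halfSpace`),

and MODULO three inputs which are NOT proved in the tree and are taken as explicit hypotheses of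
the reduction theorem `exists_highlyConnected_of_mem_signatureSet_of` (plain binders; nothing is
asserted, no named fact is introduced):

* `(h_simply)` — Kosinski X.2.2, first paragraph of the proof: the datum may be replaced by one
  with `W` SIMPLY CONNECTED (`0`- and `1`-surgeries), keeping `bW`, s-parallelizability, the
  oriented-boundary relation and the signature;
* `(h21)` — Kosinski X.(2.1), p. 200: for `W` simply connected and s-parallelizable and
  `2 ≤ j ≤ 2m - 1`, every map `Sʲ → W` is homotopic to the core of a framed embedded sphere
  `φ : Sʲ × ℝ^{4m-j} ↪ W` such that `χ(W, φ)` is again s-parallelizable;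
* `(h6)` — Kosinski X, p. 206 (proof of (3.3)) / Kervaire–Milnor p. 514: such a surgery (of index
  `≤ 2m - 1 <` half the dimension... of the closed model's middle degree) does not change the
  signature `σ` of the oriented null-cobordism.

Everything else is proved; the only definition (with body) is the induction invariant `Stage`
(a predicate of the data).  The three hypotheses are plain binders of the reduction theorem (as in
`eight_dvd_of_mem_signatureSet_of_kosinski` of `HomotopySpheresBPOrderSignatureLeavesProofs`).

## References

* A. Kosinski, *Differential Manifolds* (1993), Ch. X §1 Prop. (1.1), §2 Lemma (2.1),
  Thm. (2.2) (proof, p. 201), Prop. (3.3) (p. 206). [Kosinski1993]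
* M. Kervaire, J. Milnor, *Groups of homotopy spheres I*, Ann. of Math. 77 (1963), Thm. 5.5,
  Lemma 5.6, §7. [KervaireMilnorAnnals1963]
* A. Hatcher, *Algebraic Topology* (2002), Thm. 2A.1, Thm. 4.32. [HatcherAT2002]
-/

noncomputable section

open scoped Manifold ContDiff Topology ContinuousMap
open Set Function CategoryTheory Limits
open Literature.AlgebraicTopology.SingularHomology

namespace Literature.Topology.FourManifolds

namespace HomotopySphere

/-! ### Hurewicz bookkeeping and finiteness -/

/-- **Below the first non-vanishing homology a simply connected space has no homotopy** (Hurewicz,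
Hatcher 2002, Thm. 4.32, inductively: `π_k ≅ H_k = 0` for `2 ≤ k < j`).
[cite: HatcherAT2002, Thm. 4.32] -/
theorem subsingleton_homotopyGroup_of_subsingleton_below {X : Type} [TopologicalSpace X]
    [SimplyConnectedSpace X] (j : ℕ)
    (hH : ∀ k : ℕ, 0 < k → k < j → Subsingleton (singularHomology ℤ ℤ X k)) :
    ∀ k : ℕ, 2 ≤ k → k < j → ∀ x : X, Subsingleton (π_ k X x) := by
  intro k
  induction k using Nat.strong_induction_on with
  | _ k ih =>
    intro hk hkj x
    haveI : NeZero k := ⟨by omega⟩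
    obtain ⟨e⟩ :=
      hurewicz_iso_of_collapseDevice.{0} X k hk (fun i hi hik y => ih i hik hi (by omega) y) x
    haveI := hH k (by omega) hkj
    haveI : Subsingleton (Multiplicative (singularHomology ℤ ℤ X k)) :=
      inferInstanceAs (Subsingleton (singularHomology ℤ ℤ X k))
    exact e.toEquiv.subsingleton

/-- **`H₁(X; ℤ) = 0` for simply connected `X`** (Hurewicz in degree one, Hatcher Thm. 2A.1:
`H₁ = π₁ᵃᵇ`; tree theorem `hurewicz_one_holds`). [cite: HatcherAT2002, Thm. 2A.1] -/
theorem subsingleton_singularHomology_one {X : Type} [TopologicalSpace X] [SimplyConnectedSpace X] :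
    Subsingleton (singularHomology ℤ ℤ X 1) := by
  obtain ⟨x₀⟩ := (inferInstance : Nonempty X)
  obtain ⟨h, hsurj, -⟩ := singularHomology.hurewicz_one_holds.{0} X x₀
  have : Subsingleton (Multiplicative (singularHomology ℤ ℤ X 1)) :=
    ⟨fun a b ↦ by
      obtain ⟨a', rfl⟩ := hsurj a
      obtain ⟨b', rfl⟩ := hsurj b
      rw [Subsingleton.elim a' b']⟩
  exact this

/-- **The homology of a compact manifold with boundary is finitely generated**: a finite set of
generators of `Hₖ(W; ℤ)` (`finite_singularHomology_of_compact_chartedSpace_halfSpace`, Hatcher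
Cor. A.8–A.9). [cite: HatcherAT2002, App. A Cor. A.8 and A.9 p. 527] -/
theorem exists_finset_span_eq_top {n : ℕ} (W : Type) [TopologicalSpace W] [CompactSpace W]
    [T2Space W] [ChartedSpace (EuclideanHalfSpace (n + 1)) W] (k : ℕ) :
    ∃ G : Finset (singularHomology ℤ ℤ W k),
      Submodule.span ℤ (G : Set (singularHomology ℤ ℤ W k)) = ⊤ := by
  haveI := finite_singularHomology_of_compact_chartedSpace_halfSpace ℤ ℤ (n := n) (W := W) k
  exact Module.finite_def.1 ‹_›

/-! ### The induction invariant -/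

section Stage

variable {n : ℕ}

/-- **The induction invariant of Kosinski X.2.2 at level `j` with `r` generators** (a predicate
of the data `m, Σ, σ, μ, j, r`): an s-parallelizable null-cobordism `c` of `Σ` with `(Σ, μ) = bW`
and `σ(W) = σ`, simply connected, with `Hᵢ(W; ℤ) = 0` for `0 < i < j` and `H_j(W; ℤ)` spanned by
at most `r` classes. [cite: Kosinski1993, Ch. X §2, Thm. 2.2 (proof)] -/
def Stage (m : ℕ) (hdim : 2 * m + 2 * m = n + 1) (S : HomotopySphere n) (σ : ℤ)
    (μ : HomologicalOrientation ℤ S.carrier n) (j r : ℕ) : Prop :=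
  ∃ (c : NullCobordism n S.carrier)
    (μ' : HomologicalOrientation ℤ (ClosedModel n c.W) (n + 1)),
    SimplyConnectedSpace c.W ∧
    (∀ i : ℕ, 0 < i → i < j → Subsingleton (singularHomology ℤ ℤ c.W i)) ∧
    (∃ G : Finset (singularHomology ℤ ℤ c.W j),
      G.card ≤ r ∧ Submodule.span ℤ (G : Set (singularHomology ℤ ℤ c.W j)) = ⊤) ∧
    IsStablyParallelizable (𝓡∂ (n + 1)) c.W ∧ c.IsOrientedBy μ μ' ∧
    μ'.signatureInDim hdim = σ

variable {m : ℕ} {hdim : 2 * m + 2 * m = n + 1} {S : HomotopySphere n} {σ : ℤ}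
  {μ : HomologicalOrientation ℤ S.carrier n}

/-- **Level up**: with no generators left in degree `j`, `H_j = 0` and the invariant holds at
level `j + 1` (with the finite number of generators of `H_{j+1}`).
[cite: Kosinski1993, Ch. X §2, Thm. 2.2 (proof)] -/
theorem Stage.up {j : ℕ} (hst : Stage m hdim S σ μ j 0) : ∃ r, Stage m hdim S σ μ (j + 1) r := by
  obtain ⟨c, μ', hsc, hconn, ⟨G, hGcard, hGspan⟩, hpar, hob, hsig⟩ := hst
  have hG0 : G = ∅ := Finset.card_eq_zero.1 (Nat.le_zero.1 hGcard)
  subst hG0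
  rw [Finset.coe_empty, Submodule.span_empty] at hGspan
  have hj : Subsingleton (singularHomology ℤ ℤ c.W j) :=
    subsingleton_of_forall_eq 0 fun x ↦ (Submodule.mem_bot ℤ).1 (hGspan ▸ Submodule.mem_top)
  obtain ⟨G', hG'⟩ := exists_finset_span_eq_top (n := n) c.W (j + 1)
  refine ⟨G'.card, c, μ', hsc, fun i hi hij ↦ ?_, ⟨G', le_rfl, hG'⟩, hpar, hob, hsig⟩
  rcases Nat.lt_succ_iff_lt_or_eq.1 hij with h | rfl
  · exact hconn i hi h
  · exact hj

end Stage

/-! ### One surgery: killing a generator -/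

section Kill

variable {n : ℕ} {m : ℕ} {hdim : 2 * m + 2 * m = n + 1 + 1} {S : HomotopySphere (n + 1)} {σ : ℤ}
  {μ : HomologicalOrientation ℤ S.carrier (n + 1)}

/-- **Killing one generator** (Kosinski X.2.2, the inductive step, from X.1.1 and X.2.1): at level
`j = q + 2 ≤ 2m - 1`, a stage with `r + 1` generators yields a stage with `r` generators — pick a
generator, represent it by a sphere (Hurewicz, `exists_sphereMap_of_connected`), by a framed
embedded sphere with s-parallelizable surgery (`h21`), do the surgery (`exists_generators_surgered`,
`isZero_singularHomology_surgered`, `simplyConnectedSpace_surgered`), re-orient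
(`exists_isOrientedBy_surgery`) and compare signatures (`h6`).
[cite: Kosinski1993, Ch. X §2, Thm. 2.2 (proof)] -/
theorem Stage.kill
    (h21 : ∀ (c : NullCobordism (n + 1) S.carrier), SimplyConnectedSpace c.W →
      IsStablyParallelizable (𝓡∂ (n + 1 + 1)) c.W → ∀ (q : ℕ), q + 3 ≤ 2 * m →
      ∀ f : C(Metric.sphere (0 : EuclideanSpace ℝ (Fin (q + 1 + 1 + 1))) 1, c.W),
        ∃ (l : ℕ) (hkl : q + 1 + 1 + l = n + 1)
          (ν : FramedSphereFamily (𝓡∂ (n + 1 + 1)) c.W Unit (q + 1 + 1) (l + 1)),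
          ν.sphereMap.Homotopic f ∧
            IsStablyParallelizable (𝓡∂ (n + 1 + 1)) (c.surgery ν hkl).W)
    (h6 : ∀ (c : NullCobordism (n + 1) S.carrier) (q l : ℕ) (hkl : q + 1 + 1 + l = n + 1)
      (ν : FramedSphereFamily (𝓡∂ (n + 1 + 1)) c.W Unit (q + 1 + 1) (l + 1))
      (μ' : HomologicalOrientation ℤ (ClosedModel (n + 1) c.W) (n + 1 + 1))
      (μ'' : HomologicalOrientation ℤ (ClosedModel (n + 1) (c.surgery ν hkl).W) (n + 1 + 1)),
      q + 3 ≤ 2 * m → c.IsOrientedBy μ μ' → (c.surgery ν hkl).IsOrientedBy μ μ'' →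
        μ''.signatureInDim hdim = μ'.signatureInDim hdim)
    {q r : ℕ} (hq : q + 3 ≤ 2 * m)
    (hst : Stage m hdim S σ μ (q + 1 + 1) (r + 1)) : Stage m hdim S σ μ (q + 1 + 1) r := by
  classical
  obtain ⟨c, μ', hsc, hconn, ⟨G, hGcard, hGspan⟩, hpar, hob, hsig⟩ := hst
  haveI := hsc
  by_cases hG : G.card ≤ r
  · exact ⟨c, μ', hsc, hconn, ⟨G, hG, hGspan⟩, hpar, hob, hsig⟩
  obtain ⟨g₀, hg₀⟩ : G.Nonempty := Finset.card_pos.1 (by omega)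
  -- `W` is `(q+1)`-connected, so `g₀` is spherical
  have hπ : ∀ k : ℕ, 2 ≤ k → k < q + 2 → ∀ x : c.W, Subsingleton (π_ k c.W x) :=
    subsingleton_homotopyGroup_of_subsingleton_below (q + 2) hconn
  obtain ⟨f, θ, hfθ⟩ := exists_sphereMap_of_connected (X := c.W) q hπ g₀
  -- a framed embedded sphere in the class of `f` with s-parallelizable surgery
  obtain ⟨l, hkl, ν, hhom, hpar'⟩ := h21 c hsc hpar q hq f
  have hθ : singularHomology.map ℤ ℤ ν.sphereMap (q + 1 + 1) θ = g₀ := by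
    rw [singularHomology.map_eq_of_homotopic ℤ ℤ hhom]; exact hfθ
  have hml : q + 1 + 1 < l := by omega
  haveI : ConnectedSpace S.carrier := S.connectedSpace (Nat.succ_ne_zero n)
  haveI : Nonempty S.carrier := S.nonempty
  -- the surgery
  obtain ⟨G', hG'card, hG'span⟩ :=
    FramedSphereFamily.exists_generators_surgered ν hkl hml hGspan hg₀ hθ
  have hG'le : G'.card ≤ r := by omega
  obtain ⟨μ'', hob'⟩ := c.exists_isOrientedBy_surgery ν hkl (by omega) (by omega) hob
  refine ⟨c.surgery ν hkl, μ'', ?_, ?_, ⟨G', hG'le, hG'span⟩, hpar', hob', ?_⟩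
  · exact FramedSphereFamily.simplyConnectedSpace_surgered ν hkl (by omega) (by omega)
  · intro i hi hiq
    obtain ⟨i', rfl⟩ : ∃ i', i = i' + 1 := ⟨i - 1, by omega⟩
    haveI := hconn (i' + 1) hi hiq
    have hz : IsZero (singularHomology ℤ ℤ c.W (i' + 1)) := ModuleCat.isZero_of_subsingleton _
    exact ModuleCat.subsingleton_of_isZero
      (FramedSphereFamily.isZero_singularHomology_surgered ν hkl ℤ ℤ (m := i') (by omega)
        (by omega) hz)
  · rw [h6 c q l hkl ν μ' μ'' hq hob hob', hsig]

/-- Killing all the generators at one level. [cite: Kosinski1993, Ch. X §2, Thm. 2.2 (proof)] -/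
theorem Stage.killAll
    (h21 : ∀ (c : NullCobordism (n + 1) S.carrier), SimplyConnectedSpace c.W →
      IsStablyParallelizable (𝓡∂ (n + 1 + 1)) c.W → ∀ (q : ℕ), q + 3 ≤ 2 * m →
      ∀ f : C(Metric.sphere (0 : EuclideanSpace ℝ (Fin (q + 1 + 1 + 1))) 1, c.W),
        ∃ (l : ℕ) (hkl : q + 1 + 1 + l = n + 1)
          (ν : FramedSphereFamily (𝓡∂ (n + 1 + 1)) c.W Unit (q + 1 + 1) (l + 1)),
          ν.sphereMap.Homotopic f ∧
            IsStablyParallelizable (𝓡∂ (n + 1 + 1)) (c.surgery ν hkl).W)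
    (h6 : ∀ (c : NullCobordism (n + 1) S.carrier) (q l : ℕ) (hkl : q + 1 + 1 + l = n + 1)
      (ν : FramedSphereFamily (𝓡∂ (n + 1 + 1)) c.W Unit (q + 1 + 1) (l + 1))
      (μ' : HomologicalOrientation ℤ (ClosedModel (n + 1) c.W) (n + 1 + 1))
      (μ'' : HomologicalOrientation ℤ (ClosedModel (n + 1) (c.surgery ν hkl).W) (n + 1 + 1)),
      q + 3 ≤ 2 * m → c.IsOrientedBy μ μ' → (c.surgery ν hkl).IsOrientedBy μ μ'' →
        μ''.signatureInDim hdim = μ'.signatureInDim hdim)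
    {q : ℕ} (hq : q + 3 ≤ 2 * m) :
    ∀ r : ℕ, Stage m hdim S σ μ (q + 1 + 1) r → Stage m hdim S σ μ (q + 1 + 1) 0 := by
  intro r
  induction r with
  | zero => exact id
  | succ r ih => exact fun h ↦ ih (Stage.kill h21 h6 hq h)

end Kill

/-! ### The reduction theorem -/

/-- **Kosinski X.2.2 / X.3.3 for `P⁴ᵐ`, reduced to X.2.1, the `1`-connectivity step and the
invariance of `σ`**: GIVEN (as hypotheses) the simply-connected reduction (`h_simply`),
framed representability with s-parallelizable surgery (`h21`, X.2.1) and the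
invariance of the signature under these surgeries (`h6`), every element of
`signatureSet g m h Σ` is the signature of a simply connected s-parallelizable null-cobordism with
`Hᵢ = 0` for `0 < i < 2m` and the same oriented boundary —
`HomotopySphere.exists_highlyConnected_of_mem_signatureSet`.  The induction on the level
`j = 2, …, 2m - 1` and on the number of generators of `H_j` is carried out here from the proved
bricks. [cite: Kosinski1993, Ch. X §2, Thm. 2.2 (proof)] -/
theorem exists_highlyConnected_of_mem_signatureSet_of
    (h_simply : ∀ (n m : ℕ) (hdim : 2 * m + 2 * m = n + 1), 1 < m → ∀ (S : HomotopySphere n)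
      (μ : HomologicalOrientation ℤ S.carrier n) (c : NullCobordism n S.carrier)
      (μ' : HomologicalOrientation ℤ (ClosedModel n c.W) (n + 1)),
      IsStablyParallelizable (𝓡∂ (n + 1)) c.W → c.IsOrientedBy μ μ' →
        ∃ (c₁ : NullCobordism n S.carrier)
          (μ₁' : HomologicalOrientation ℤ (ClosedModel n c₁.W) (n + 1)),
          SimplyConnectedSpace c₁.W ∧ IsStablyParallelizable (𝓡∂ (n + 1)) c₁.W ∧
            c₁.IsOrientedBy μ μ₁' ∧ μ₁'.signatureInDim hdim = μ'.signatureInDim hdim)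
    (h21 : ∀ (n m : ℕ), 2 * m + 2 * m = n + 1 → 1 < m → ∀ (S : HomotopySphere n)
      (c : NullCobordism n S.carrier), SimplyConnectedSpace c.W →
      IsStablyParallelizable (𝓡∂ (n + 1)) c.W → ∀ (q : ℕ), q + 3 ≤ 2 * m →
        ∀ f : C(Metric.sphere (0 : EuclideanSpace ℝ (Fin (q + 1 + 1 + 1))) 1, c.W),
          ∃ (l : ℕ) (hkl : q + 1 + 1 + l = n)
            (ν : FramedSphereFamily (𝓡∂ (n + 1)) c.W Unit (q + 1 + 1) (l + 1)),
            ν.sphereMap.Homotopic f ∧ IsStablyParallelizable (𝓡∂ (n + 1)) (c.surgery ν hkl).W)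
    (h6 : ∀ (n m : ℕ) (hdim : 2 * m + 2 * m = n + 1), 1 < m → ∀ (S : HomotopySphere n)
      (c : NullCobordism n S.carrier) (q l : ℕ) (hkl : q + 1 + 1 + l = n)
      (ν : FramedSphereFamily (𝓡∂ (n + 1)) c.W Unit (q + 1 + 1) (l + 1))
      (μ : HomologicalOrientation ℤ S.carrier n)
      (μ' : HomologicalOrientation ℤ (ClosedModel n c.W) (n + 1))
      (μ'' : HomologicalOrientation ℤ (ClosedModel n (c.surgery ν hkl).W) (n + 1)),
      q + 3 ≤ 2 * m → c.IsOrientedBy μ μ' → (c.surgery ν hkl).IsOrientedBy μ μ'' →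
        μ''.signatureInDim hdim = μ'.signatureInDim hdim) :
    exists_highlyConnected_of_mem_signatureSet := by
  intro n m h hm g S σ hσ
  obtain ⟨n, rfl⟩ : ∃ n', n = n' + 1 := ⟨n - 1, by omega⟩
  have hdim : 2 * m + 2 * m = n + 1 + 1 := by omega
  obtain ⟨μ, c, μ', hcompat, hpar, hob, hsig⟩ := mem_signatureSet_iff.1 hσ
  -- stage 2
  obtain ⟨c₁, μ₁', hsc₁, hpar₁, hob₁, hsig₁⟩ := h_simply (n + 1) m hdim hm S μ c μ' hpar hob
  have h2 : ∃ r, Stage m hdim S σ μ 2 r := by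
    haveI := hsc₁
    obtain ⟨G, hG⟩ := exists_finset_span_eq_top (n := n + 1) c₁.W 2
    refine ⟨G.card, c₁, μ₁', hsc₁, fun i hi hi2 ↦ ?_, ⟨G, le_rfl, hG⟩, hpar₁, hob₁, ?_⟩
    · obtain rfl : i = 1 := by omega
      exact subsingleton_singularHomology_one
    · rw [hsig₁]; exact hsig
  -- the induction on the level
  have key : ∀ q : ℕ, q + 2 ≤ 2 * m → ∃ r, Stage m hdim S σ μ (q + 2) r := by
    intro q
    induction q with
    | zero => exact fun _ ↦ h2
    | succ q ih =>
      intro hq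
      obtain ⟨r, hr⟩ := ih (by omega)
      have h0 : Stage m hdim S σ μ (q + 1 + 1) 0 :=
        Stage.killAll (h21 (n + 1) m hdim hm S)
          (fun c q l hkl ν μ' μ'' ↦ h6 (n + 1) m hdim hm S c q l hkl ν μ μ' μ'') (by omega) r hr
      obtain ⟨r', hr'⟩ := h0.up
      exact ⟨r', hr'⟩
  obtain ⟨r, c', μ'', hsc, hconn, -, hpar', hob', hsig'⟩ := key (2 * m - 2) (by omega)
  refine ⟨μ, c', μ'', hsc, fun i hi hi2 ↦ hconn i hi (by omega), hcompat, hpar', hob', ?_⟩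
  exact hsig'

end HomotopySphere

end Literature.Topology.FourManifolds
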